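import Mathlib

/-!
# Two continuous kernels of one integral operator agree everywhere (support, seat p1)

On a compact space `X` carrying a finite measure `μ` that is positive on open sets, a continuous kernel
`K : X × X → ℂ` defines the integral operator `ψ ↦ (x ↦ ∫ K(x, y) ψ(y) dμ(y))`. If two continuous kernels
`K₁`, `K₂` give the same operator on continuous test functions — even only up to a `μ`-null set of `x` for
each `ψ` — then `K₁ = K₂` everywhere (`eq_of_forall_continuous_integral_ae_eq`):

* for each continuous `ψ` the two parametric integrals are continuous in `x`
  (`continuous_kernel_integral`, a dominated-convergence / compactness fact), so «equal a.e.» upgrades to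
  «equal everywhere» (`Continuous.ae_eq_iff_eq`, positivity of `μ` on open sets);
* for a fixed `x` the difference `D = K₁(x, ·) − K₂(x, ·)` is continuous and kills every continuous `ψ`;
  testing against `ψ = conj D` gives `∫ |D|² dμ = 0`, hence `D = 0` a.e. and, by continuity, everywhere
  (`eq_zero_of_forall_integral_mul_eq_zero`).

This is the abstract form of the step «two continuous kernels of the same operator on `L²([G])` agree a.e.,
hence everywhere» in the two-kernel derivation of a two-period identity for an `L¹` test function (STATUS
l. 14985 (2)(c), t7-x1): the unfolded Poincaré-series kernel and the finite spectral kernel of `R(f)` are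
both continuous on the compact `[G] × [G]`, and agreeing on `L²` they agree on continuous test functions.
Nothing here is about any group, any period, or (N).

Blind lane: Mathlib only; no sorry; axioms ⊆ {propext, Classical.choice, Quot.sound}.
-/

namespace Summit.Ventures.HodgeRepro2.T7SupportKernelUnique

open MeasureTheory Filter Topology

variable {X : Type*} [TopologicalSpace X] [CompactSpace X] [MeasurableSpace X] [OpensMeasurableSpace X]
  (μ : Measure X) [IsFiniteMeasure μ]

/-- a continuous function on a compact space is integrable for a finite measure -/
theorem integrable_of_continuous (f : X → ℂ) (hf : Continuous f) : Integrable f μ :=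
  hf.integrable_of_hasCompactSupport (HasCompactSupport.of_compactSpace f)

/-- a continuous real function on a compact space is integrable for a finite measure -/
theorem integrable_of_continuous_real (f : X → ℝ) (hf : Continuous f) : Integrable f μ :=
  hf.integrable_of_hasCompactSupport (HasCompactSupport.of_compactSpace f)

/-- **the integral operator of a continuous kernel maps continuous functions to continuous functions**:
`x ↦ ∫ K(x, y) ψ(y) dμ(y)` is continuous for `K` continuous on `X × X` and `ψ` continuous. -/
theorem continuous_kernel_integral [LocallyCompactSpace X] [FirstCountableTopology X]
    (K : X → X → ℂ) (hK : Continuous (Function.uncurry K)) (ψ : X → ℂ) (hψ : Continuous ψ) :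
    Continuous fun x => ∫ y, K x y * ψ y ∂μ := by
  have hF : Continuous (Function.uncurry fun x y => K x y * ψ y) := by
    have : (Function.uncurry fun x y => K x y * ψ y) =
        fun p : X × X => Function.uncurry K p * ψ p.2 := by
      funext p
      rfl
    rw [this]
    exact hK.mul (hψ.comp continuous_snd)
  have := continuous_parametric_integral_of_continuous (μ := μ) hF isCompact_univ
  simpa only [Measure.restrict_univ] using this

/-- **a continuous function orthogonal to every continuous function vanishes**: if `D : X → ℂ` is continuous
and `∫ D ψ dμ = 0` for every continuous `ψ`, then `D = 0` (test against `ψ = conj D`). -/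
theorem eq_zero_of_forall_integral_mul_eq_zero [μ.IsOpenPosMeasure] (D : X → ℂ) (hD : Continuous D)
    (h : ∀ ψ : X → ℂ, Continuous ψ → ∫ y, D y * ψ y ∂μ = 0) : D = 0 := by
  have hconj : Continuous fun y => (starRingEnd ℂ) (D y) := Complex.continuous_conj.comp hD
  have h0 := h _ hconj
  -- `D · conj D = |D|²`
  have e : (fun y => D y * (starRingEnd ℂ) (D y)) = fun y => ((Complex.normSq (D y) : ℝ) : ℂ) := by
    funext y
    exact Complex.mul_conj (D y)
  rw [e, integral_complex_ofReal, Complex.ofReal_eq_zero] at h0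
  have hnn : 0 ≤ fun y => Complex.normSq (D y) := fun y => Complex.normSq_nonneg (D y)
  have hcont : Continuous fun y => Complex.normSq (D y) := Complex.continuous_normSq.comp hD
  have hint : Integrable (fun y => Complex.normSq (D y)) μ := integrable_of_continuous_real μ _ hcont
  have hae : (fun y => Complex.normSq (D y)) =ᵐ[μ] 0 := (integral_eq_zero_iff_of_nonneg hnn hint).1 h0
  have heq : (fun y => Complex.normSq (D y)) = 0 := (Continuous.ae_eq_iff_eq μ hcont continuous_const).1 hae
  funext y
  have := congrFun heq y
  exact Complex.normSq_eq_zero.1 this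

/-- **uniqueness of a continuous kernel**: two continuous kernels whose integral operators agree on every
continuous test function, up to a `μ`-null set of `x` for each `ψ`, are equal. -/
theorem eq_of_forall_continuous_integral_ae_eq [LocallyCompactSpace X] [FirstCountableTopology X]
    [μ.IsOpenPosMeasure] (K₁ K₂ : X → X → ℂ) (h₁ : Continuous (Function.uncurry K₁))
    (h₂ : Continuous (Function.uncurry K₂))
    (hop : ∀ ψ : X → ℂ, Continuous ψ →
      (fun x => ∫ y, K₁ x y * ψ y ∂μ) =ᵐ[μ] fun x => ∫ y, K₂ x y * ψ y ∂μ) :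
    K₁ = K₂ := by
  -- the a.e. equality of the two continuous parametric integrals is an equality everywhere
  have hall : ∀ ψ : X → ℂ, Continuous ψ → ∀ x, ∫ y, K₁ x y * ψ y ∂μ = ∫ y, K₂ x y * ψ y ∂μ := by
    intro ψ hψ
    have := (Continuous.ae_eq_iff_eq μ (continuous_kernel_integral μ K₁ h₁ ψ hψ)
      (continuous_kernel_integral μ K₂ h₂ ψ hψ)).1 (hop ψ hψ)
    exact fun x => congrFun this x
  funext x
  -- the difference kernel at `x` kills every continuous `ψ`
  have hDc : Continuous fun y => K₁ x y - K₂ x y := by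
    have hx : Continuous fun y : X => (x, y) := continuous_const.prodMk continuous_id
    exact (h₁.comp hx).sub (h₂.comp hx)
  have hD : (fun y => K₁ x y - K₂ x y) = 0 := by
    refine eq_zero_of_forall_integral_mul_eq_zero μ _ hDc fun ψ hψ => ?_
    have hi₁ : Integrable (fun y => K₁ x y * ψ y) μ := by
      refine integrable_of_continuous μ _ ?_
      have hx : Continuous fun y : X => (x, y) := continuous_const.prodMk continuous_id
      exact (h₁.comp hx).mul hψ
    have hi₂ : Integrable (fun y => K₂ x y * ψ y) μ := by
      refine integrable_of_continuous μ _ ?_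
      have hx : Continuous fun y : X => (x, y) := continuous_const.prodMk continuous_id
      exact (h₂.comp hx).mul hψ
    have e : (fun y => (K₁ x y - K₂ x y) * ψ y) = fun y => K₁ x y * ψ y - K₂ x y * ψ y := by
      funext y
      ring
    rw [e, integral_sub hi₁ hi₂, hall ψ hψ x, sub_self]
  funext y
  have := congrFun hD y
  simp only [Pi.zero_apply, sub_eq_zero] at this
  exact this

/-- the same with the operators agreeing everywhere (no null set) -/
theorem eq_of_forall_continuous_integral_eq [LocallyCompactSpace X] [FirstCountableTopology X]
    [μ.IsOpenPosMeasure] (K₁ K₂ : X → X → ℂ) (h₁ : Continuous (Function.uncurry K₁))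
    (h₂ : Continuous (Function.uncurry K₂))
    (hop : ∀ ψ : X → ℂ, Continuous ψ → ∀ x, ∫ y, K₁ x y * ψ y ∂μ = ∫ y, K₂ x y * ψ y ∂μ) :
    K₁ = K₂ :=
  eq_of_forall_continuous_integral_ae_eq μ K₁ K₂ h₁ h₂ fun ψ hψ =>
    Eventually.of_forall (hop ψ hψ)

end Summit.Ventures.HodgeRepro2.T7SupportKernelUnique
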